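import Literature.NumberTheory.Transcendental.CijsouwWaldschmidt1977Main
import Literature.NumberTheory.Transcendental.Waldschmidt1980ParamsB
import Literature.NumberTheory.Transcendental.Waldschmidt1980KStepFar
import HarnessLib

/-!
# Waldschmidt 1980, Prop. 3.8 over `ℚ` (`q = 2`): the sizes

Support file (one `Prop`-valued structure and theorems; no named facts) for the archimedean
input of the Stewart–Yu 1991 line of `Literature.Barriers.ABC.stewartYu1991_upperBound`
(M. Waldschmidt, *A lower bound for linear forms in logarithms*, Acta Arith. **37** (1980),
Prop. 3.8 over `ℚ`, `q = 2`).

Part I of the assembly, on the objects of the tree's Cijsouw–Waldschmidt files (`CW77.Setup`: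
`d` free positive rationals `αⱼ`, the eliminated one `θ`, `Λ₀ = ∑ βⱼ log αⱼ − log θ`) with the
parameters `W80Par` of `Waldschmidt1980Params.lean`: the link `W80Hyp` between the data and the
sizes (`|log αⱼ|, h(αⱼ) ≤ Vⱼ`, `|log θ|, h(θ) ≤ V_θ`, `|bⱼ|, |b_θ| ≤ e^W`) and the bounds, in the
unit `𝔘 = U/2ᵐ`, of every quantity entering Siegel's lemma, the extrapolations and the Liouville
estimates: the moderate ones are `≤ 𝔅 = e^{𝔘/64}`, the height factors are `≤ exp(c S₀ Σ LᵢVᵢ)`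
with `S₀ Σ LᵢVᵢ ≤ 𝔘/(2c_L')` ((3.11) of the paper).

## References

* [Waldschmidt1980] M. Waldschmidt, *A lower bound for linear forms in logarithms*, Acta Arith. 37
  (1980), 257–283 — §3.2–3.4 (pp. 264–270).
* [CijsouwWaldschmidt1977] P. L. Cijsouw, M. Waldschmidt, Compositio Math. 34 (1977) — §4 (the
  pattern of the tree's `CijsouwWaldschmidt1977Main.lean`, Part I, which this file follows).
-/

noncomputable section

open Finset Real
open Literature.NumberTheory.Transcendental.Baker1975
open Literature.NumberTheory.Transcendental.Waldschmidt1980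
open Literature.NumberTheory.Transcendental.Waldschmidt1980.W80Par

namespace Literature.NumberTheory.Transcendental.Waldschmidt1980.W80Par

variable {d : ℕ} (P : W80Par d)

/-- All the sizes: `V` extended by `V_θ` at the last place. [folklore] -/
def Vall : Fin (d + 1) → ℝ := Fin.snoc P.V P.Vθ

/-- All the ranges: `L` extended by `L_θ`. [folklore] -/
def Lall : Fin (d + 1) → ℕ := Fin.snoc P.L P.Lθ

/-- `Vall (castSucc j) = V j`. [folklore] -/
@[simp] theorem Vall_castSucc (j : Fin d) : P.Vall (Fin.castSucc j) = P.V j := by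
  unfold Vall; rw [Fin.snoc_castSucc]

/-- `Vall last = V_θ`. [folklore] -/
@[simp] theorem Vall_last : P.Vall (Fin.last d) = P.Vθ := by
  unfold Vall; rw [Fin.snoc_last]

/-- `Lall (castSucc j) = L j`. [folklore] -/
@[simp] theorem Lall_castSucc (j : Fin d) : P.Lall (Fin.castSucc j) = P.L j := by
  unfold Lall; rw [Fin.snoc_castSucc]

/-- `Lall last = L_θ`. [folklore] -/
@[simp] theorem Lall_last : P.Lall (Fin.last d) = P.Lθ := by
  unfold Lall; rw [Fin.snoc_last]

/-- `1 ≤ Vallᵢ`. [folklore] -/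
theorem one_le_Vall (i : Fin (d + 1)) : 1 ≤ P.Vall i := by
  refine Fin.lastCases ?_ (fun j => ?_) i
  · rw [P.Vall_last]; exact P.one_le_Vθ
  · rw [P.Vall_castSucc]; exact P.hV j

/-- `0 < Vallᵢ`. [folklore] -/
theorem Vall_pos (i : Fin (d + 1)) : 0 < P.Vall i := lt_of_lt_of_le one_pos (P.one_le_Vall i)

/-- The height exponent unit `LV = ∑ᵢ Lallᵢ Vallᵢ = ∑ⱼ LⱼVⱼ + L_θ V_θ`. [folklore] -/
theorem sum_Lall_Vall : ∑ i, (P.Lall i : ℝ) * P.Vall i = (∑ j, (P.L j : ℝ) * P.V j) + P.Lθ * P.Vθ := by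
  rw [Fin.sum_univ_castSucc]; simp

/-- **`S₀ ∑ᵢ Lallᵢ Vallᵢ ≤ 𝔘/(2c_L')`** ((3.11)). [cite: Waldschmidt1980, (3.11) (p. 265)] -/
theorem S₀_sum_LV_le : (P.S₀ : ℝ) * ∑ i, (P.Lall i : ℝ) * P.Vall i ≤ P.𝔘 / (2 * cL') := by
  rw [P.sum_Lall_Vall]; exact P.S₀LV_le

/-- `0 ≤ ∑ Lallᵢ Vallᵢ`. [folklore] -/
theorem sum_LV_nonneg : 0 ≤ ∑ i, (P.Lall i : ℝ) * P.Vall i :=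
  sum_nonneg fun i _ => mul_nonneg (Nat.cast_nonneg _) (P.Vall_pos i).le

/-- `∑ Vallᵢ = ∑ Vⱼ + V_θ ≤ 2⁻⁹⁰ 𝔘`. [folklore] -/
theorem sum_Vall_le : ∑ i, P.Vall i ≤ P.𝔘 / 2 ^ 90 := by
  rw [Fin.sum_univ_castSucc]; simp only [Vall_castSucc, Vall_last]
  have := P.sumV_le_𝔘
  rw [le_div_iff₀ (by positivity)]; linarith

/-- `Lallᵢ ≤ U` (the denominators of the `Lᵢ` are `≥ 1`). [folklore] -/
theorem Lall_le_U (i : Fin (d + 1)) : (P.Lall i : ℝ) ≤ P.U := by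
  have hU := P.U_pos; have hS := P.S₀_pos; have hm := two_le_mR P
  have hS1 : (1 : ℝ) ≤ P.S₀ := by have := P.two_le_S₀; exact_mod_cast (by omega : 1 ≤ P.S₀)
  have key : ∀ (V : ℝ), 1 ≤ V → (⌊P.U / (cL' * mR d * 2 ^ (d + 2) * P.S₀ * V)⌋₊ : ℝ) ≤ P.U := by
    intro V hV
    have hden : 1 ≤ cL' * mR d * 2 ^ (d + 2) * P.S₀ * V := by
      unfold cL'
      have h4 : (1 : ℝ) ≤ 2 ^ (d + 2) := one_le_pow₀ (by norm_num)
      calc (1 : ℝ) = 1 * 1 * 1 * 1 * 1 := by ring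
        _ ≤ 2 ^ 12 * mR d * 2 ^ (d + 2) * P.S₀ * V := by gcongr <;> linarith
    refine (Nat.floor_le (div_nonneg hU.le (by linarith))).trans ?_
    exact div_le_self hU.le hden
  refine Fin.lastCases ?_ (fun j => ?_) i
  · rw [P.Lall_last]; exact key _ P.one_le_Vθ
  · rw [P.Lall_castSucc]; exact key _ (P.hV j)

end Literature.NumberTheory.Transcendental.Waldschmidt1980.W80Par

namespace Literature.NumberTheory.Transcendental.CW77

namespace Setup

variable (S : Setup)

/-- **The link between the data `S` and Waldschmidt's parameters `P`**: the free logarithms have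
sizes `≤ Vⱼ`, the eliminated one `≤ V_θ`, the coefficients are `≤ e^W`.
[cite: Waldschmidt1980, §3.1 (3.1) (p. 263)] -/
structure W80Hyp (P : W80Par S.d) : Prop where
  /-- `log H(αⱼ) ≤ Vⱼ` -/
  hH : ∀ j, Real.log (hgt (S.α j)) ≤ P.V j
  /-- `|log αⱼ| ≤ Vⱼ` -/
  hl : ∀ j, |S.l j| ≤ P.V j
  /-- `log H(θ) ≤ V_θ` -/
  hHθ : Real.log (hgt S.θ) ≤ P.Vθ
  /-- `|log θ| ≤ V_θ` -/
  hlθ : |S.lθ| ≤ P.Vθ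
  /-- `|bⱼ| ≤ e^W` -/
  hb : ∀ j, |(S.b j : ℝ)| ≤ Real.exp P.W
  /-- `|b_θ| ≤ e^W` -/
  hbθ : |(S.bθ : ℝ)| ≤ Real.exp P.W

variable {S}
variable {P : W80Par S.d} (hy : S.W80Hyp P)
include hy

/-- `log H(allᵢ) ≤ Vallᵢ`. [folklore] -/
theorem W80Hyp.log_hgt_all_le (i : Fin (S.d + 1)) : Real.log (hgt (S.all i)) ≤ P.Vall i := by
  refine Fin.lastCases ?_ (fun j => ?_) i
  · rw [P.Vall_last]; unfold all; rw [Fin.snoc_last]; exact hy.hHθ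
  · rw [P.Vall_castSucc]; unfold all; rw [Fin.snoc_castSucc]; exact hy.hH j

/-- `H(allᵢ) ≤ exp Vallᵢ`. [folklore] -/
theorem W80Hyp.hgt_le (i : Fin (S.d + 1)) : hgt (S.all i) ≤ Real.exp (P.Vall i) := by
  have := hy.log_hgt_all_le i
  rwa [Real.log_le_iff_le_exp (hgt_pos _)] at this

/-- `H(allᵢ)^e ≤ exp(e Vallᵢ)`. [folklore] -/
theorem W80Hyp.hgt_pow_le (i : Fin (S.d + 1)) (e : ℕ) : hgt (S.all i) ^ e ≤ Real.exp (e * P.Vall i) := by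
  rw [Real.exp_nat_mul]
  exact pow_le_pow_left₀ (hgt_pos _).le (hy.hgt_le i) e

/-- `1 + ∑ |lⱼ| ≤ 1 + ∑ Vⱼ`. [folklore] -/
theorem W80Hyp.one_add_sum_abs_l_le : 1 + ∑ j, |S.l j| ≤ 1 + ∑ j, P.V j := by
  linarith [sum_le_sum fun j (_ : j ∈ univ) => hy.hl j]

/-- `|βⱼ| ≤ e^W`. [folklore] -/
theorem W80Hyp.abs_β_le (j : Fin S.d) : |(S.β j : ℝ)| ≤ Real.exp P.W := by
  unfold β
  push_cast
  rw [abs_div, abs_neg]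
  have hbθ : (1 : ℝ) ≤ |(S.bθ : ℝ)| := by
    have h := Int.one_le_abs S.bθ_ne
    exact_mod_cast h
  calc |(S.b j : ℝ)| / |(S.bθ : ℝ)| ≤ |(S.b j : ℝ)| / 1 :=
        div_le_div_of_nonneg_left (abs_nonneg _) one_pos hbθ
    _ = |(S.b j : ℝ)| := div_one _
    _ ≤ Real.exp P.W := hy.hb j

/-- `|γⱼ(u)| ≤ 2 U e^W` on the box of level `J`. [folklore] -/
theorem W80Hyp.abs_γ_le {J : ℕ} {u : Idx S.d P.hpar P.Lb}
    (hu : u ∈ S.box (h := P.hpar) (Lb := P.Lb) P.L P.Lθ J) (j : Fin S.d) :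
    |(S.γ u j : ℝ)| ≤ 2 * P.U * Real.exp P.W := by
  rw [S.mem_box] at hu
  unfold γ
  push_cast
  have h1 : (u.2.1 j : ℝ) ≤ P.U := by
    have : (u.2.1 j : ℝ) ≤ P.L j := by exact_mod_cast (hu.1 j).trans (Nat.div_le_self _ _)
    exact this.trans (by simpa using P.Lall_le_U (Fin.castSucc j))
  have h2 : (u.2.2 : ℝ) ≤ P.U := by
    have : (u.2.2 : ℝ) ≤ P.Lθ := by exact_mod_cast hu.2.trans (Nat.div_le_self _ _)
    exact this.trans (by simpa using P.Lall_le_U (Fin.last S.d))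
  have hW : 1 ≤ Real.exp P.W := Real.one_le_exp (by linarith [P.hW])
  have hU := P.U_pos
  calc |(u.2.1 j : ℝ) + (u.2.2 : ℝ) * (S.β j : ℝ)| ≤ |(u.2.1 j : ℝ)| + |(u.2.2 : ℝ) * (S.β j : ℝ)| :=
        abs_add_le _ _
    _ = (u.2.1 j : ℝ) + (u.2.2 : ℝ) * |(S.β j : ℝ)| := by
        rw [abs_mul, Nat.abs_cast, Nat.abs_cast]
    _ ≤ P.U + P.U * Real.exp P.W := add_le_add h1 (mul_le_mul h2 (hy.abs_β_le j) (abs_nonneg _) hU.le)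
    _ ≤ 2 * P.U * Real.exp P.W := by nlinarith

omit hy in
/-- `log(2 U e^W) ≤ 11 W⋆ + 1`. [folklore] -/
theorem w80_log_Γ_le (P : W80Par S.d) : Real.log (2 * P.U * Real.exp P.W) ≤ 11 * P.Wstar + 1 := by
  have hU := P.U_pos
  rw [Real.log_mul (by positivity) (Real.exp_pos _).ne', Real.log_mul (by norm_num) hU.ne', Real.log_exp]
  have h1 := P.log_U_le; have h2 := P.W_le_Wstar
  have h3 : Real.log 2 ≤ 1 := by have := Real.log_two_lt_d9; linarith
  linarith

omit hy in
/-- `1 ≤ 2 U e^W`. [folklore] -/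
theorem w80_one_le_Γ (P : W80Par S.d) : (1 : ℝ) ≤ 2 * P.U * Real.exp P.W := by
  have hW : 1 ≤ Real.exp P.W := Real.one_le_exp (by linarith [P.hW])
  have hU : 1 ≤ P.U := by
    have := P.U_div_ge'; have hW1 := P.one_le_Wstar
    have h2 : (1 : ℝ) ≤ 2 ^ (49 * (S.d + 1)) := one_le_pow₀ (by norm_num)
    have h3 : P.U / (2 ^ (S.d + 1) * P.Wstar) ≤ P.U := div_le_self P.U_pos.le (by
      have : (1 : ℝ) ≤ 2 ^ (S.d + 1) := one_le_pow₀ (by norm_num)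
      nlinarith)
    linarith
  nlinarith

/-- **`|qA(u, τ')| ≤ 𝔅`** on the box, `|τ'| ≤ T`: `(2Ue^W)^T = exp(T (11W⋆+1)) ≤ exp(12 𝔘/c_T)`.
[cite: Waldschmidt1980, §3.3 (proof of Lemma 3.3, p. 268)] -/
theorem W80Hyp.abs_qA_le {J : ℕ} {u : Idx S.d P.hpar P.Lb} (hu : u ∈ S.box (h := P.hpar) (Lb := P.Lb) P.L P.Lθ J)
    {τ' : Fin S.d → ℕ} (hτ : ∑ j, τ' j ≤ P.T) : |(S.qA u τ' : ℝ)| ≤ P.𝔅 := by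
  set Γ := 2 * P.U * Real.exp P.W with hΓ
  have hΓ1 : 1 ≤ Γ := w80_one_le_Γ P
  have h1 : |(S.qA u τ' : ℝ)| ≤ Γ ^ P.T := by
    unfold qA; push_cast
    rw [abs_prod]
    calc ∏ j, |(S.γ u j : ℝ) ^ τ' j| = ∏ j, |(S.γ u j : ℝ)| ^ τ' j := prod_congr rfl fun j _ => abs_pow _ _
      _ ≤ ∏ j, Γ ^ τ' j := prod_le_prod (fun j _ => by positivity)
          fun j _ => pow_le_pow_left₀ (abs_nonneg _) (hy.abs_γ_le hu j) _
      _ = Γ ^ ∑ j, τ' j := (prod_pow_eq_pow_sum _ _ _)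
      _ ≤ Γ ^ P.T := pow_le_pow_right₀ hΓ1 hτ
  refine h1.trans (P.le_𝔅_of_log_le ?_)
  rw [Real.log_pow]
  have hT := P.T_pos; have hTW := P.TWstar_le; have hTU := P.T_le_𝔘; have hW := P.one_le_Wstar
  calc (P.T : ℝ) * Real.log Γ ≤ P.T * (11 * P.Wstar + 1) := mul_le_mul_of_nonneg_left (w80_log_Γ_le P) hT.le
    _ = 11 * (P.T * P.Wstar) + P.T := by ring
    _ ≤ 11 * (P.𝔘 / cT) + P.𝔘 / cT := by gcongr
    _ ≤ P.𝔘 / 64 := by unfold cT; have := P.𝔘_pos; nlinarith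

/-- `‖A(u, τ')‖ ≤ 𝔅` likewise. [folklore] -/
theorem W80Hyp.norm_A_le {J : ℕ} {u : Idx S.d P.hpar P.Lb} (hu : u ∈ S.box (h := P.hpar) (Lb := P.Lb) P.L P.Lθ J)
    {τ' : Fin S.d → ℕ} (hτ : ∑ j, τ' j ≤ P.T) : ‖S.A u τ'‖ ≤ P.𝔅 := by
  rw [S.A_eq]
  have : ‖((S.qA u τ' : ℚ) : ℂ)‖ = |(S.qA u τ' : ℝ)| := by
    rw [← Complex.ofReal_ratCast, Complex.norm_real, Real.norm_eq_abs]
  rw [this]; exact hy.abs_qA_le hu hτ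

/-! ### Height factors -/

omit hy in
/-- **`∑ eᵢ Vallᵢ ≤ c 𝔘/(2c_L')`** when `eᵢ ≤ c Lallᵢ S₀`. [folklore] -/
theorem sum_eV_le (P : W80Par S.d) {e : Fin (S.d + 1) → ℕ} {c : ℕ} (he : ∀ i, e i ≤ c * P.Lall i * P.S₀) :
    ∑ i, (e i : ℝ) * P.Vall i ≤ c * (P.𝔘 / (2 * cL')) := by
  have h1 : ∑ i, (e i : ℝ) * P.Vall i ≤ c * (P.S₀ * ∑ i, (P.Lall i : ℝ) * P.Vall i) := by
    rw [mul_sum, mul_sum]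
    refine sum_le_sum fun i _ => ?_
    have : (e i : ℝ) ≤ c * P.Lall i * P.S₀ := by exact_mod_cast he i
    have hV := (P.Vall_pos i).le
    calc (e i : ℝ) * P.Vall i ≤ (c * P.Lall i * P.S₀) * P.Vall i := mul_le_mul_of_nonneg_right this hV
      _ = c * (P.S₀ * ((P.Lall i : ℝ) * P.Vall i)) := by ring
  exact h1.trans (mul_le_mul_of_nonneg_left P.S₀_sum_LV_le (Nat.cast_nonneg _))

/-- **`∏ H(allᵢ)^{eᵢ} ≤ exp(c 𝔘/(2c_L'))`** when `eᵢ ≤ c Lallᵢ S₀`. [folklore] -/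
theorem W80Hyp.prod_hgt_pow_le {e : Fin (S.d + 1) → ℕ} {c : ℕ} (he : ∀ i, e i ≤ c * P.Lall i * P.S₀) :
    ∏ i, hgt (S.all i) ^ e i ≤ Real.exp (c * (P.𝔘 / (2 * cL'))) := by
  calc ∏ i, hgt (S.all i) ^ e i ≤ ∏ i, Real.exp (e i * P.Vall i) :=
        prod_le_prod (fun i _ => pow_nonneg (hgt_pos _).le _) fun i _ => hy.hgt_pow_le i (e i)
    _ = Real.exp (∑ i, (e i : ℝ) * P.Vall i) := (Real.exp_sum _ _).symm
    _ ≤ Real.exp (c * (P.𝔘 / (2 * cL'))) := Real.exp_le_exp.mpr (sum_eV_le P he)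

/-- **The denominators `∏ den(αⱼ)^{eⱼ} · den θ^{e_θ} ≤ exp(c 𝔘/(2c_L'))`** when `eⱼ ≤ c Lⱼ S₀`,
`e_θ ≤ c L_θ S₀`. [folklore] -/
theorem W80Hyp.den_prod_le {e : Fin S.d → ℕ} {eθ : ℕ} {c : ℕ} (he : ∀ j, e j ≤ c * P.L j * P.S₀)
    (heθ : eθ ≤ c * P.Lθ * P.S₀) :
    (((∏ j, (S.α j).den ^ e j) * S.θ.den ^ eθ : ℕ) : ℝ) ≤ Real.exp (c * (P.𝔘 / (2 * cL'))) := by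
  set e' : Fin (S.d + 1) → ℕ := Fin.snoc e eθ with he'
  have hall : (((∏ j, (S.α j).den ^ e j) * S.θ.den ^ eθ : ℕ) : ℝ) = ∏ i, ((S.all i).den : ℝ) ^ e' i := by
    push_cast
    rw [Fin.prod_univ_castSucc]
    unfold all
    simp only [he', Fin.snoc_castSucc, Fin.snoc_last]
  rw [hall]
  have he'' : ∀ i, e' i ≤ c * P.Lall i * P.S₀ := by
    intro i
    refine Fin.lastCases ?_ (fun j => ?_) i
    · simp only [he', Fin.snoc_last, W80Par.Lall_last]; exact heθ
    · simp only [he', Fin.snoc_castSucc, W80Par.Lall_castSucc]; exact he j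
  refine le_trans ?_ (hy.prod_hgt_pow_le he'')
  refine prod_le_prod (fun i _ => by positivity) fun i _ => ?_
  exact pow_le_pow_left₀ (by positivity) (den_le_hgt _) _

/-- **`|qE(u, s)| ≤ exp(𝔘/(2c_L'))`** on the box of level `0`, `s ≤ S₀`. [folklore] -/
theorem W80Hyp.abs_qE_le {u : Idx S.d P.hpar P.Lb} (hu : u ∈ S.box (h := P.hpar) (Lb := P.Lb) P.L P.Lθ 0)
    {s : ℕ} (hs : s ≤ P.S₀) : |(S.qE u s : ℝ)| ≤ Real.exp (1 * (P.𝔘 / (2 * cL'))) := by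
  rw [S.mem_box] at hu
  simp only [pow_zero, Nat.div_one] at hu
  unfold qE; push_cast
  rw [abs_of_nonneg (by
    refine mul_nonneg (prod_nonneg fun j _ => pow_nonneg ?_ _) (pow_nonneg ?_ _)
    · exact_mod_cast (S.α_pos j).le
    · exact_mod_cast S.θ_pos.le)]
  set e' : Fin (S.d + 1) → ℕ := Fin.snoc (fun j => u.2.1 j * s) (u.2.2 * s) with he'
  have hall : (∏ j, (S.α j : ℝ) ^ (u.2.1 j * s)) * (S.θ : ℝ) ^ (u.2.2 * s) = ∏ i, ((S.all i : ℚ) : ℝ) ^ e' i := by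
    rw [Fin.prod_univ_castSucc]
    unfold all
    simp only [he', Fin.snoc_castSucc, Fin.snoc_last]
  rw [hall]
  have he'' : ∀ i, e' i ≤ 1 * P.Lall i * P.S₀ := by
    intro i
    refine Fin.lastCases ?_ (fun j => ?_) i
    · simp only [he', Fin.snoc_last, W80Par.Lall_last, one_mul]; exact Nat.mul_le_mul hu.2 hs
    · simp only [he', Fin.snoc_castSucc, W80Par.Lall_castSucc, one_mul]; exact Nat.mul_le_mul (hu.1 j) hs
  have key := hy.prod_hgt_pow_le he''
  push_cast at key
  refine le_trans ?_ key
  refine prod_le_prod (fun i _ => pow_nonneg (by exact_mod_cast (S.all_pos i).le) _) fun i _ => ?_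
  exact pow_le_pow_left₀ (by exact_mod_cast (S.all_pos i).le) (self_le_hgt _) _

/-- **`|qEh(u, s)| ≤ exp(2 𝔘/(2c_L'))`** on the box of level `J`, `s ≤ 2^{J+1} S₀`. [folklore] -/
theorem W80Hyp.abs_qEh_le {J : ℕ} {u : Idx S.d P.hpar P.Lb} (hu : u ∈ S.box (h := P.hpar) (Lb := P.Lb) P.L P.Lθ J)
    {s : ℕ} (hs : s ≤ 2 ^ (J + 1) * P.S₀) : |(S.qEh u s : ℝ)| ≤ Real.exp (2 * (P.𝔘 / (2 * cL'))) := by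
  rw [S.mem_box] at hu
  unfold qEh; push_cast
  rw [abs_of_nonneg (prod_nonneg fun i _ => pow_nonneg (by exact_mod_cast (S.all_pos i).le) _)]
  have hdiv : ∀ (lam Lq : ℕ), lam ≤ Lq / 2 ^ J → lam * s / 2 ≤ 2 * Lq * P.S₀ := by
    intro lam Lq hl
    calc lam * s / 2 ≤ lam * s := Nat.div_le_self _ _
      _ ≤ (Lq / 2 ^ J) * (2 ^ (J + 1) * P.S₀) := Nat.mul_le_mul hl hs
      _ = 2 * ((Lq / 2 ^ J) * 2 ^ J) * P.S₀ := by rw [pow_succ]; ring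
      _ ≤ 2 * Lq * P.S₀ := by
          have := Nat.div_mul_le_self Lq (2 ^ J)
          exact Nat.mul_le_mul_right _ (Nat.mul_le_mul_left _ this)
  have he'' : ∀ i, S.expn u s i / 2 ≤ 2 * P.Lall i * P.S₀ := by
    intro i
    refine Fin.lastCases ?_ (fun j => ?_) i
    · rw [S.expn_last, W80Par.Lall_last]; exact hdiv _ _ hu.2
    · rw [S.expn_castSucc, W80Par.Lall_castSucc]; exact hdiv _ _ (hu.1 j)
  have := hy.prod_hgt_pow_le he''
  push_cast at this
  refine le_trans ?_ this
  refine prod_le_prod (fun i _ => pow_nonneg (by exact_mod_cast (S.all_pos i).le) _) fun i _ => ?_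
  exact pow_le_pow_left₀ (by exact_mod_cast (S.all_pos i).le) (self_le_hgt _) _

/-- **`P(all) ≤ exp(∑ Vallᵢ)`** (the height product of the Liouville estimate). [folklore] -/
theorem W80Hyp.heightProd_le : heightProd S.all ≤ Real.exp (∑ i, P.Vall i) := by
  unfold heightProd
  rw [Real.exp_sum]
  exact prod_le_prod (fun i _ => (hgt_pos _).le) fun i _ => hy.hgt_le i

/-- `|ψ(u)| ≤ (∑ Lallᵢ Vallᵢ) / 2^J` on the box of level `J`. [folklore] -/
theorem W80Hyp.abs_ψ_le {J : ℕ} {u : Idx S.d P.hpar P.Lb} (hu : u ∈ S.box (h := P.hpar) (Lb := P.Lb) P.L P.Lθ J) :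
    |S.ψ u| ≤ (∑ i, (P.Lall i : ℝ) * P.Vall i) / 2 ^ J := by
  rw [S.mem_box] at hu
  unfold ψ
  have hcast : ∀ (lam Lq : ℕ), lam ≤ Lq / 2 ^ J → (lam : ℝ) ≤ (Lq : ℝ) / 2 ^ J := by
    intro lam Lq h
    calc (lam : ℝ) ≤ ((Lq / 2 ^ J : ℕ) : ℝ) := by exact_mod_cast h
      _ ≤ (Lq : ℝ) / 2 ^ J := by
          have := Nat.cast_div_le (α := ℝ) (m := Lq) (n := 2 ^ J)
          push_cast at this; exact this
  have h1 : |∑ j, (u.2.1 j : ℝ) * S.l j + (u.2.2 : ℝ) * S.lθ| ≤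
      ∑ j, (P.L j : ℝ) / 2 ^ J * P.V j + (P.Lθ : ℝ) / 2 ^ J * P.Vθ := by
    refine (abs_add_le _ _).trans (add_le_add ((abs_sum_le_sum_abs _ _).trans (sum_le_sum fun j _ => ?_)) ?_)
    · rw [abs_mul, Nat.abs_cast]
      exact mul_le_mul (hcast _ _ (hu.1 j)) (hy.hl j) (abs_nonneg _) (by positivity)
    · rw [abs_mul, Nat.abs_cast]
      exact mul_le_mul (hcast _ _ hu.2) hy.hlθ (abs_nonneg _) (by positivity)
  refine h1.trans (le_of_eq ?_)
  rw [P.sum_Lall_Vall, add_div, sum_div]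
  congr 1
  · exact sum_congr rfl fun j _ => by ring
  · ring

/-- `|ψ(u) + λ_θ Λ₀| ≤ (∑ Lallᵢ Vallᵢ + 1) / 2^J` on the box of level `J`, when `L_θ |Λ₀| ≤ 1`.
[folklore] -/
theorem W80Hyp.abs_expo_le {J : ℕ} {u : Idx S.d P.hpar P.Lb} (hu : u ∈ S.box (h := P.hpar) (Lb := P.Lb) P.L P.Lθ J)
    (hΛ : (P.Lθ : ℝ) * |S.Λ₀| ≤ 1) :
    |S.expo u| ≤ (∑ i, (P.Lall i : ℝ) * P.Vall i + 1) / 2 ^ J := by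
  have h1 := hy.abs_ψ_le hu
  rw [S.mem_box] at hu
  unfold expo
  have h2 : |(u.2.2 : ℝ) * S.Λ₀| ≤ 1 / 2 ^ J := by
    rw [abs_mul, Nat.abs_cast]
    have h3 : (u.2.2 : ℝ) ≤ (P.Lθ : ℝ) / 2 ^ J := by
      calc (u.2.2 : ℝ) ≤ ((P.Lθ / 2 ^ J : ℕ) : ℝ) := by exact_mod_cast hu.2
        _ ≤ (P.Lθ : ℝ) / 2 ^ J := by
            have := Nat.cast_div_le (α := ℝ) (m := P.Lθ) (n := 2 ^ J)
            push_cast at this; exact this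
    calc (u.2.2 : ℝ) * |S.Λ₀| ≤ (P.Lθ : ℝ) / 2 ^ J * |S.Λ₀| := mul_le_mul_of_nonneg_right h3 (abs_nonneg _)
      _ = (P.Lθ : ℝ) * |S.Λ₀| / 2 ^ J := by ring
      _ ≤ 1 / 2 ^ J := div_le_div_of_nonneg_right hΛ (by positivity)
  calc |S.ψ u + (u.2.2 : ℝ) * S.Λ₀| ≤ |S.ψ u| + |(u.2.2 : ℝ) * S.Λ₀| := abs_add_le _ _
    _ ≤ (∑ i, (P.Lall i : ℝ) * P.Vall i) / 2 ^ J + 1 / 2 ^ J := add_le_add h1 h2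
    _ = (∑ i, (P.Lall i : ℝ) * P.Vall i + 1) / 2 ^ J := by ring

omit hy in
/-- **`Ψ_J · 65 · SK ≤ 65 · 2ᵏ · (𝔘/(2c_L') + S₀)`** with `Ψ_J = (∑ LᵢVᵢ + 1)/2^J` and
`SK = 2^{k+J} S₀`: the growth exponent of `f_{J,τ}` on the far circle. [folklore] -/
theorem Ψ_mul_le (P : W80Par S.d) (J k : ℕ) :
    (∑ i, (P.Lall i : ℝ) * P.Vall i + 1) / 2 ^ J * (65 * ((2 ^ (k + J) * P.S₀ : ℕ) : ℝ)) ≤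
      65 * 2 ^ k * (P.𝔘 / (2 * cL') + P.S₀) := by
  have h2 : (0 : ℝ) < 2 ^ J := by positivity
  have e1 : (∑ i, (P.Lall i : ℝ) * P.Vall i + 1) / 2 ^ J * (65 * ((2 ^ (k + J) * P.S₀ : ℕ) : ℝ)) =
      65 * 2 ^ k * (P.S₀ * (∑ i, (P.Lall i : ℝ) * P.Vall i) + P.S₀) := by
    rw [div_mul_eq_mul_div, div_eq_iff h2.ne']; push_cast; rw [pow_add]; ring
  rw [e1]
  have h3 := P.S₀_sum_LV_le
  gcongr

end Setup

end Literature.NumberTheory.Transcendental.CW77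

end
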